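import Mathlib
import HarnessLib
import Summits.Ventures.LatticeQCDFlow.Scaling.Bhattacharyya
import Summits.Ventures.LatticeQCDFlow.Scaling.Acceptance

/-!
# LatticeQCDFlow / Scaling — Le Cam on the PAIR laws: `(1 − acc)² + BC⁴ ≤ 1`, i.e.
# `1 − √(1 − BC(p,q)⁴) ≤ acc(p, q) ≤ BC(p, q)²`

HONEST FRAMING: exact (Metropolis-corrected) sampling algorithms for lattice gauge theory;
figures of merit are autocorrelation/cost numbers at stated couplings and volumes; no
continuum-physics claim.

Venture `LatticeQCDFlow` (cell pub-lqcd), topic `Scaling`; FANOUT row 3 (`s0-u1-a`, S0-B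
implementation A, GEN-11).  NEW WORK of the cell (a two-line combination of tree facts), not a
published result; NO definition is introduced.  Row 31's `Scaling/Bhattacharyya` (imported) has the
CEILING `acc ≤ BC²` (T2-M, `accRate_le_bhatt_sq`) and Le Cam's `BC² ≤ 1 − TV²` (`bhatt_sq_le`);
theory-2's `Scaling/Acceptance` (imported) writes the acceptance as a total variation between the
two PAIR laws, `acc(p, q) = 1 − ‖p⊗q − q⊗p‖_TV` (`accRate_eq_one_sub_tvDist_prodLaw`).  The
Bhattacharyya coefficient tensorises (`bhatt_prodLaw`, the two-factor form of row 31's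
`bhatt_blockProd`) and is symmetric, so `BC(p⊗q, q⊗p) = BC(p, q)²`, and Le Cam applied to the pair
laws gives the matching FLOOR:

* `bhatt_comm`, `bhatt_prodLaw`, `bhatt_prodLaw_swap` (`BC(p⊗q, q⊗p) = BC(p,q)²`);
* **`sq_one_sub_accRate_add_bhatt_pow_four_le_one`** — `(1 − acc(p,q))² + BC(p,q)⁴ ≤ 1`;
* **`one_sub_sqrt_le_accRate_of_bhatt`** — `1 − √(1 − BC⁴) ≤ acc`, and the two-sided
  **`accRate_mem_Icc_bhatt`** — `acc ∈ [1 − √(1 − BC⁴), BC²]`: the equilibrium acceptance of the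
  exact chain is pinned by the Bhattacharyya affinity of target and model (`BC = E_q[√w]`, a
  half-moment of the importance weight, finite even without a weight ceiling); since
  `1 − √(1 − BC⁴) ≥ BC⁴/2`, in particular `acc ≥ BC⁴/2` (`half_bhatt_pow_four_le_accRate`).

Against the single-law Le Cam floor `acc ≥ 1 − 2·TV ≥ 1 − 2√(1 − BC²)` (T2-X + Le Cam) the pair-law
floor loses `√(1 + BC²) ≤ √2` instead of `2` in the deficit.  NOT CLAIMED: attainment of the floor
(Le Cam's equality case forces `p = q` here); any number of ours; nothing re-scored.
-/

namespace Summit.Ventures.LatticeQCDFlow.Theory2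

open Finset Literature.Probability.MarkovChains
open Summit.Ventures.LatticeQCDFlow.Exactness

variable {X Y : Type*} [Fintype X] [Fintype Y]

omit [Fintype Y] in
/-- The Bhattacharyya coefficient is symmetric. [folklore] -/
theorem bhatt_comm (p q : X → ℝ) : bhatt p q = bhatt q p := by
  unfold bhatt
  exact sum_congr rfl fun x _ => by rw [mul_comm]

/-- **Tensorisation, two factors**: `BC(p₁⊗p₂, q₁⊗q₂) = BC(p₁, q₁)·BC(p₂, q₂)` for nonnegative
laws (only the first pair's nonnegativity is used). [folklore] -/
theorem bhatt_prodLaw {p₁ q₁ : X → ℝ} (p₂ q₂ : Y → ℝ) (hp₁ : ∀ x, 0 ≤ p₁ x)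
    (hq₁ : ∀ x, 0 ≤ q₁ x) :
    bhatt (prodLaw p₁ p₂) (prodLaw q₁ q₂) = bhatt p₁ q₁ * bhatt p₂ q₂ := by
  unfold bhatt prodLaw
  rw [Fintype.sum_prod_type, sum_mul_sum]
  refine sum_congr rfl fun x _ => sum_congr rfl fun y _ => ?_
  rw [← Real.sqrt_mul (mul_nonneg (hp₁ x) (hq₁ x))]
  congr 1
  simp only
  ring

omit [Fintype Y] in
/-- `BC(p⊗q, q⊗p) = BC(p, q)²`. [ours] -/
theorem bhatt_prodLaw_swap {p q : X → ℝ} (hp : ∀ x, 0 ≤ p x) (hq : ∀ x, 0 ≤ q x) :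
    bhatt (prodLaw p q) (prodLaw q p) = bhatt p q ^ 2 := by
  rw [bhatt_prodLaw q p hp hq, ← bhatt_comm p q, sq]

omit [Fintype Y] in
/-- **Le Cam on the pair laws: `(1 − acc(p, q))² + BC(p, q)⁴ ≤ 1`** for normalised nonnegative
`p`, `q` (`1 − acc = ‖p⊗q − q⊗p‖_TV` and `BC(p⊗q, q⊗p)² = BC⁴ ≤ 1 − TV²`). [ours] -/
theorem sq_one_sub_accRate_add_bhatt_pow_four_le_one {p q : X → ℝ} (hp : ∀ x, 0 ≤ p x)
    (hq : ∀ x, 0 ≤ q x) (hp1 : ∑ x, p x = 1) (hq1 : ∑ x, q x = 1) :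
    (1 - accRate p q) ^ 2 + bhatt p q ^ 4 ≤ 1 := by
  have hP1 : ∑ z, prodLaw p q z = 1 := by rw [sum_prodLaw, hp1, hq1, mul_one]
  have hQ1 : ∑ z, prodLaw q p z = 1 := by rw [sum_prodLaw, hp1, hq1, one_mul]
  have hLC := bhatt_sq_le (p := prodLaw p q) (q := prodLaw q p)
    (fun z : X × X => mul_nonneg (hp z.1) (hq z.2)) (fun z : X × X => mul_nonneg (hq z.1) (hp z.2))
    hP1 hQ1
  rw [bhatt_prodLaw_swap hp hq, ← pow_mul] at hLC
  rw [accRate_eq_one_sub_tvDist_prodLaw hp1 hq1, sub_sub_cancel]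
  norm_num at hLC
  linarith

omit [Fintype Y] in
/-- **The Bhattacharyya FLOOR: `1 − √(1 − BC(p,q)⁴) ≤ acc(p, q)`.** [ours] -/
theorem one_sub_sqrt_le_accRate_of_bhatt {p q : X → ℝ} (hp : ∀ x, 0 ≤ p x) (hq : ∀ x, 0 ≤ q x)
    (hp1 : ∑ x, p x = 1) (hq1 : ∑ x, q x = 1) :
    1 - Real.sqrt (1 - bhatt p q ^ 4) ≤ accRate p q := by
  have h := sq_one_sub_accRate_add_bhatt_pow_four_le_one hp hq hp1 hq1
  have h1 : 1 - accRate p q ≤ Real.sqrt (1 - bhatt p q ^ 4) :=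
    Real.le_sqrt_of_sq_le (by linarith)
  linarith

omit [Fintype Y] in
/-- **Two-sided: `acc(p, q) ∈ [1 − √(1 − BC⁴), BC²]`** — the floor above with row 31's ceiling
`accRate_le_bhatt_sq`. [ours] -/
theorem accRate_mem_Icc_bhatt {p q : X → ℝ} (hp : ∀ x, 0 ≤ p x) (hq : ∀ x, 0 ≤ q x)
    (hp1 : ∑ x, p x = 1) (hq1 : ∑ x, q x = 1) :
    accRate p q ∈ Set.Icc (1 - Real.sqrt (1 - bhatt p q ^ 4)) (bhatt p q ^ 2) :=
  ⟨one_sub_sqrt_le_accRate_of_bhatt hp hq hp1 hq1, accRate_le_bhatt_sq hp hq⟩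

omit [Fintype Y] in
/-- **`acc ≥ BC⁴/2`** (since `√(1 − t) ≤ 1 − t/2` for `t = BC⁴ ∈ [0, 1]`). [ours] -/
theorem half_bhatt_pow_four_le_accRate {p q : X → ℝ} (hp : ∀ x, 0 ≤ p x) (hq : ∀ x, 0 ≤ q x)
    (hp1 : ∑ x, p x = 1) (hq1 : ∑ x, q x = 1) :
    bhatt p q ^ 4 / 2 ≤ accRate p q := by
  have h := sq_one_sub_accRate_add_bhatt_pow_four_le_one hp hq hp1 hq1
  have ht0 : 0 ≤ bhatt p q ^ 4 := by positivity
  have ht1 : bhatt p q ^ 4 ≤ 1 := by nlinarith [sq_nonneg (1 - accRate p q)]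
  have hs : Real.sqrt (1 - bhatt p q ^ 4) ≤ 1 - bhatt p q ^ 4 / 2 := by
    refine Real.sqrt_le_iff.mpr ⟨by linarith, ?_⟩
    nlinarith
  linarith [one_sub_sqrt_le_accRate_of_bhatt hp hq hp1 hq1]

end Summit.Ventures.LatticeQCDFlow.Theory2
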